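import Mathlib
import Summits.Ventures.PercRepro.TriangleCapRowGeneralEq

/-!
# PercRepro — the extremal graphs strictly above the threshold are the star plus `t` disjoint leaf edges:
the structure behind the dominating vertex (p3, gen 31; part 14 — the companion of TriangleCapRowGeneralEq)

**`star_matching_of_cherries_eq`**: for `t ≥ 4`, `t² + 8 ≤ 2k + t`, a `K₄⁻`-free graph with `k − 1 + t` edges
and `C(k − 1, 2) + 2t` cherries has a vertex `v` with `d(v) = k − 1` such that every pair off `v` lies inside
`N(v)`, every neighbour of `v` has at most one neighbour inside `N(v)` (the matching property), and the pairs off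
`v` number `2t` — i.e. `D` is the star at `v` plus a matching of exactly `t` edges among the leaves.
Axioms: standard.
-/

namespace PercRepro

namespace TriangleCap

namespace C047

open Finset

variable {V : Type*} [Fintype V] [DecidableEq V]

/-- **THE EXTREMAL GRAPHS STRICTLY ABOVE THE THRESHOLD:** a dominating vertex `v`, every pair off `v` inside
`N(v)`, `N(v)` inducing a matching, and exactly `2t` ordered pairs (`t` edges) off `v`. -/
theorem star_matching_of_cherries_eq (t : ℕ) (ht : 4 ≤ t) (D : SimpleGraph V) [DecidableRel D.Adj]
    (hK : K4mFree D) (hk : t * t + 8 ≤ 2 * Fintype.card V + t)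
    (hm : D.edgeFinset.card + 1 = Fintype.card V + t)
    (heq : cherries D = (Fintype.card V - 1).choose 2 + 2 * t) :
    ∃ v, deg D v + 1 = Fintype.card V ∧
      (∀ p ∈ offPairs D v, D.Adj v p.1 ∧ D.Adj v p.2) ∧
      (∀ w, D.Adj v w → ((univ.filter (fun x => D.Adj v x)).filter (fun x => D.Adj w x)).card ≤ 1) ∧
      (offPairs D v).card = 2 * t := by
  obtain ⟨v, hv⟩ := exists_dominating_of_cherries_eq t ht D hK hk hm heq
  refine ⟨v, hv, ?_, ?_, ?_⟩
  · intro p hp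
    rw [mem_offPairs] at hp
    exact ⟨adj_of_deg_add_one_eq_card D hv hp.2.1, adj_of_deg_add_one_eq_card D hv hp.2.2⟩
  · intro w hw
    exact card_filter_adj_neighbors_le_one D hK hw
  · have h := two_mul_card_edges_eq D v
    omega

end C047

end TriangleCap

end PercRepro
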